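import Literature.AlgebraicGeometry.HodgeTheory.TypeIIMinimalPowersHodgeClasses
import Literature.RingTheory.CentralSimple.PositiveInvolutionFirstKindRealStructure
import HarnessLib

/-!
# Hodge classes on all powers of a simple complex abelian variety of ALBERT TYPE II with minimal dimension `dim A = 2[K:ℚ]` — from the Albert data «`End⁰(A)` a totally indefinite quaternion algebra over a totally real field `K`» (Mumford §21 Thm. 2, type II; Lange Thm. 2.6.5 (b)), through the tree's real structure `ℝ ⊗ End⁰(A) ≅ ∏_{w ∣ ∞} M₂(ℝ)`; Banaszak–Gajda–Krasoń 2006 Thm. 7.34 (`h = 1`), Moonen–Zarhin 1999 (2.2), V. K. Murty 1988 Thm. 2 (`m = 1`), PROVED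

Family `hodge`, layer `Literature/AlgebraicGeometry/HodgeTheory`. Research context: cell `pub-hodge-ring2`
(HONEST FRAMING: research route conditional on HC_CM; not a corollary; Q11.4-sentence-2 already refuted in
dim ≥ 3), Literature lane, programme R8 «type II minimal from the Albert data». UNCONDITIONAL and FACT-FREE:
theorems only, no definition, no named fact (D-0026); no step towards a summit statement (published theorems:
Banaszak–Gajda–Krasoń 2006 Thm. 7.34, Murty 1988 Thm. 2, Moonen–Zarhin 1999 (2.2)).

THE BRIDGE. Programme R7 (`HodgeTheory/TypeIIMinimalPowersHodgeClasses`) proved `B•(A^{N+1}) = D•(A^{N+1}) ⊗ ℂ`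
and the Hodge conjecture for all powers of a SIMPLE complex abelian variety `A` from ONE hypothesis, an explicit
REAL SPLITTING `Φ : ℝ ⊗_ℚ End⁰(A) ≃ₐ[ℝ] ∏_ι M₂(ℝ)` with `dim A = 2|ι|`, and recorded as NOT PROVIDED the passage
from the Albert data of type II — «`End⁰(A)` is a totally indefinite quaternion algebra over a totally real
number field `K`» (split at the COMPLETIONS `K_w`, the tree's `IsTotallyIndefinite K End⁰(A)`) — to such a
`Φ`. That passage IS in the tree, in the Albert-classification library
(`RingTheory/CentralSimple/PositiveInvolutionFirstKindRealStructure`, §6, involution-free form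
`exists_realModels_algEquiv_pi_matrix_of_isTotallyIndefinite`: every totally indefinite quaternion DIVISION
algebra `D` over a totally real number field `K` has `ℝ ⊗_ℚ D ≃ₐ[ℝ] ∏_{w ∣ ∞} M₂(ℝ)` — Lange's
«`End_ℚ(X) ⊗_ℚ ℝ ≃ ∏_{ν=1}^{e} M₂(ℝ)` by Theorem 2.6.5 and Lemma 2.6.4», §2.6.1, proof of the Proposition,
second case; Mumford §21, table of Thm. 2, type II: `D ⊗_ℚ ℝ ≅ M₂(ℝ) × ⋯ × M₂(ℝ)`). This file composes the two:
for a simple `A`, `End⁰(A)` is a division ring (Mumford §19 Cor. 2 of Thm. 1, the tree's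
`isUnit_or_eq_zero_of_isSimple`), the infinite places of a totally real `K` number `[K:ℚ]`
(`card_infinitePlace_eq_finrank_of_isTotallyReal`), so

  `A` SIMPLE, `K` totally real, `End⁰(A)` a quaternion algebra over `K` split at every infinite place,
  `dim A = 2[K:ℚ]`  ⟹  `B•(A^{N+1}) = D•(A^{N+1}) ⊗ ℂ` and the Hodge conjecture for every `A^{N+1}` and
  everything isogenous (§2), «no factor of type IV» (§1), and the cell's product rows with CM factors (§4).

This is Banaszak–Gajda–Krasoń's class 𝒜 of TYPE II with `h = 1` IN THEIR OWN WORDS (p. 36: «type II … `D` is an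
indefinite quaternion algebra with center `E` such that `D ⊗_ℚ ℝ = ∏ M_{2,2}(ℝ)`»; p. 60: `g = hed`, `d = 2`,
`h = 1`), Moonen–Zarhin's Type 2(1) for `K = ℚ` («`D = End⁰(X)` is a quaternion algebra over `ℚ`, split at `∞`»,
§3: the surface spelling `…_of_surface_isTotallyIndefinite`), and the atlas row II(3) of the cell for a totally
real cubic `K` (§3: `…_sixfold_…`); V. K. Murty 1988 Thm. 2 with `m = 1` covers them after the choice of a totally
real maximal subfield, which neither R7 nor this file needs. The involution-KEYED form (§2,
`…_of_isAlbertTypeII`: a pair `(End⁰(A), ι')` of Albert type II in the tree's sorting key `IsAlbertTypeII`) is the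
same theorem, the key carrying `K` totally real, the quaternion structure and total indefiniteness.

NOT CLAIMED: that the Rosati involution of a polarization makes `(End⁰(A), †)` a pair of type II whenever
`End⁰(A)` is a quaternion algebra over a totally real field with `dim A = 2[K:ℚ]` (this needs Shimura's exclusion
of type III with `m = 1`, not in the tree); types II with `h ≥ 3` (B–G–K's class 𝒜 in general; `𝔰𝔭_{2h}`
invariants); any Summits file.

## References

* [Lange2023AbelianVarietiesComplex] H. Lange, *Abelian Varieties over the Complex Numbers*, Grundlehren Text
  Edition (2023), §2.6.1, Proposition (table) and its proof, second case (PDF p0138 L14–L20, L28–L31); §2.6.2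
  Thm. 2.6.5 (b) (p0141 L30–L34) and proof Step II (p0142 L18–L21).
  [cite: Lange2023AbelianVarietiesComplex, §2.6.1 Proposition and Thm. 2.6.5 (b)]
* [MumfordAV1970] D. Mumford, *Abelian Varieties* (1970), §19 Cor. 2 of Thm. 1 (p. 174); §21 Thm. 2 and its
  table (type II: `D ⊗_ℚ ℝ ≅ M₂(ℝ) × ⋯ × M₂(ℝ)`, restriction `2e ∣ g`) (pp. 201–202).
  [cite: MumfordAV1970, §21 Thm. 2 (type II)]
* [BanaszakGajdaKrason2006] G. Banaszak, W. Gajda, P. Krasoń, *On the image of l-adic Galois representations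
  for abelian varieties of type I and II*, Doc. Math. Extra Vol. Coates (2006) 35–75 (held
  `paper:doi-10-4171-dms-4-2`): p. 36 (type II), Definition of class 𝒜 (p. 60), Cor. 7.19 (7.22) (p. 67),
  Thm. 7.34 (p. 69). [cite: BanaszakGajdaKrason2006, p. 36 and Thm. 7.34]
* [MoonenZarhin1999LowDim] B. Moonen, Yu. G. Zarhin, *Hodge classes on abelian varieties of low dimension*,
  Math. Ann. 315 (1999) 711–733, (2.2) Type 2(1), (1.8), §3 (3.1). [cite: MoonenZarhin1999LowDim, (2.2) and (1.8)]
* [Murty1988] V. Kumar Murty, *The Hodge group of an abelian variety*, Proc. AMS 104 (1988) 61–68, Thm. 2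
  (p. 67) and §1 Remark 1. [cite: Murty1988, Thm. 2 (p. 67)]
* [Lombardo2016] D. Lombardo, Ann. Inst. Fourier 66 (2016), Lemma 3.4 (p. 1229). [cite: Lombardo2016, Lemma 3.4 (p. 1229)]
* [vanGeemen1994HodgeAV] B. van Geemen, LNM 1594 (1994), Lemma 3.7. [cite: vanGeemen1994HodgeAV, Lemma 3.7]
* [Deligne2000] P. Deligne, The Hodge conjecture (Clay problem statement), §1. [cite: Deligne2000, §1]
-/

noncomputable section

open scoped TensorProduct
open CategoryTheory Module NumberField

namespace Literature.AlgebraicGeometry.HodgeTheory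

open Literature.AlgebraicGeometry.Motives (AbelianVariety)
open Literature.AlgebraicGeometry.ComplexMultiplication
open Literature.RingTheory.CentralSimple
open Literature.NumberTheory.Automorphic (IsQuaternionAlgebra)

variable {A : AbelianVariety ℂ} {K : Type} [Field K] [NumberField K]

/-! ### §0 The number of infinite places of a totally real field -/

variable (K) in
/-- A totally real number field `K` has exactly `[K:ℚ]` infinite places (all real: `r₁ = [K:ℚ]`, `r₂ = 0`;
Lange's «denote by `σ₁, …, σ_e` the different embeddings of `K`», `e = [K:ℚ]`, in Step II of the proof of
Thm. 2.6.5). Mathlib plumbing (`card = r₁ + r₂`, `r₂ = 0`, `[K:ℚ] = r₁` for `IsTotallyReal`).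
[cite: Lange2023AbelianVarietiesComplex, Thm. 2.6.5 proof Step II (PDF p0142 L20–L22)] -/
theorem card_infinitePlace_eq_finrank_of_isTotallyReal [IsTotallyReal K] :
    Fintype.card (InfinitePlace K) = Module.finrank ℚ K := by
  rw [InfinitePlace.card_eq_nrRealPlaces_add_nrComplexPlaces, IsTotallyReal.nrComplexPlaces_eq_zero, add_zero,
    IsTotallyReal.finrank]

/-! ### §1 The real splitting of `End⁰(A)` from the Albert data of type II, and «no factor of type IV» -/

section AlbertData

variable [Algebra K A.endAlgebra] [IsScalarTower ℚ K A.endAlgebra] [IsQuaternionAlgebra K A.endAlgebra]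

/-- **The real structure of a type II endomorphism algebra (Mumford §21 Thm. 2, type II: `D ⊗_ℚ ℝ ≅ M₂(ℝ) × ⋯ ×
M₂(ℝ)`; Lange §2.6.1 / Thm. 2.6.5 (b)).** For a SIMPLE complex abelian variety `A` whose endomorphism algebra
`End⁰(A)` is a quaternion algebra over a totally real number field `K`, split at every infinite place of `K`,
there is a real splitting `ℝ ⊗_ℚ End⁰(A) ≃ₐ[ℝ] ∏_{w ∣ ∞} M₂(ℝ)` indexed by the infinite places of `K`
(`End⁰(A)` is a division ring by Mumford §19 Cor. 2; then the tree's
`exists_realModels_algEquiv_pi_matrix_of_isTotallyIndefinite`). [cite: MumfordAV1970, §21 Thm. 2 (type II)]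
[cite: Lange2023AbelianVarietiesComplex, §2.6.1 Proposition and Thm. 2.6.5 (b)] -/
theorem nonempty_realSplitting_of_isSimple_isTotallyIndefinite [IsTotallyReal K] (hA : A.IsSimple)
    (hind : IsTotallyIndefinite K A.endAlgebra) :
    Nonempty (ℝ ⊗[ℚ] A.endAlgebra ≃ₐ[ℝ] (InfinitePlace K → Matrix (Fin 2) (Fin 2) ℝ)) := by
  have hD : ∀ x : A.endAlgebra, x ≠ 0 → IsUnit x := fun x hx =>
    (isUnit_or_eq_zero_of_isSimple hA x).resolve_right hx
  obtain ⟨-, Φ, -, -⟩ := exists_realModels_algEquiv_pi_matrix_of_isTotallyIndefinite K hD hind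
  exact ⟨Φ⟩

/-- **Albert: a type II endomorphism algebra has no factor of type IV** (its centre is totally real), in the
tree's currency `HasNoTypeIVFactor A`, for a simple `A` with `End⁰(A)` a totally indefinite quaternion algebra
over a totally real `K` (through the real splitting and R7's `hasNoTypeIVFactor_of_realSplitting`).
[cite: MumfordAV1970, §21 Thm. 2 (type II)] [cite: BanaszakGajdaKrason2006, p. 36 and Thm. 7.34] -/
theorem hasNoTypeIVFactor_of_isSimple_isTotallyIndefinite [IsTotallyReal K] (hA : A.IsSimple)
    (hind : IsTotallyIndefinite K A.endAlgebra) : HasNoTypeIVFactor A := by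
  obtain ⟨Φ⟩ := nonempty_realSplitting_of_isSimple_isTotallyIndefinite hA hind
  exact hasNoTypeIVFactor_of_realSplitting Φ

/-! ### §2 Type II with `dim A = 2[K:ℚ]`: `B•(A^{N+1}) = D•(A^{N+1}) ⊗ ℂ` and the Hodge conjecture for all powers -/

variable (A) in
/-- **Type II minimal from the Albert data, all powers, PROVED: `B•(A^{N+1}) = D•(A^{N+1}) ⊗ ℂ`** for a simple
complex abelian variety `A` whose endomorphism algebra is a quaternion algebra over a totally real number field
`K`, split at every infinite place of `K`, with `dim A = 2[K:ℚ]` (Banaszak–Gajda–Krasoń's class 𝒜 of type II with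
`h = 1`; Murty 1988 Thm. 2, `m = 1`; Moonen–Zarhin Type 2(1) when `K = ℚ`) — R7's
`AbelianVariety.isDivisorGenerated_powSucc_of_isSimple_realSplitting` at the real splitting of §1.
[cite: BanaszakGajdaKrason2006, p. 36 and Thm. 7.34] [cite: Murty1988, Thm. 2 (p. 67)]
[cite: MumfordAV1970, §21 Thm. 2 (type II)] -/
theorem AbelianVariety.isDivisorGenerated_powSucc_of_isSimple_isTotallyIndefinite [IsTotallyReal K]
    (hA : A.IsSimple) (hind : IsTotallyIndefinite K A.endAlgebra) (hdim : A.dim = 2 * Module.finrank ℚ K)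
    (N : ℕ) : IsDivisorGenerated (A.powSucc N) := by
  classical
  obtain ⟨Φ⟩ := nonempty_realSplitting_of_isSimple_isTotallyIndefinite hA hind
  exact AbelianVariety.isDivisorGenerated_powSucc_of_isSimple_realSplitting A hA Φ
    (by rw [card_infinitePlace_eq_finrank_of_isTotallyReal K]; exact hdim) N

variable (A) in
/-- `A` itself: `B•(A) = D•(A) ⊗ ℂ` for a simple `A` of type II with `dim A = 2[K:ℚ]`.
[cite: BanaszakGajdaKrason2006, Thm. 7.34] [cite: MoonenZarhin1999LowDim, (2.2) and (1.8)] -/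
theorem AbelianVariety.isDivisorGenerated_of_isSimple_isTotallyIndefinite [IsTotallyReal K] (hA : A.IsSimple)
    (hind : IsTotallyIndefinite K A.endAlgebra) (hdim : A.dim = 2 * Module.finrank ℚ K) :
    IsDivisorGenerated A := by
  classical
  obtain ⟨Φ⟩ := nonempty_realSplitting_of_isSimple_isTotallyIndefinite hA hind
  exact AbelianVariety.isDivisorGenerated_of_isSimple_realSplitting A hA Φ
    (by rw [card_infinitePlace_eq_finrank_of_isTotallyReal K]; exact hdim)

/-- **The Hodge conjecture for all powers `A^{N+1}` of a simple complex abelian variety of Albert type II with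
minimal dimension `dim A = 2[K:ℚ]` — UNCONDITIONAL, from the Albert data alone** (`End⁰(A)` a quaternion algebra
over a totally real `K`, split at all infinite places): Banaszak–Gajda–Krasoń 2006 Thm. 7.34 for `h = 1`, `d = 2`;
Murty 1988 Thm. 2 (`m = 1`) and §1 Remark 1. [cite: BanaszakGajdaKrason2006, p. 36 and Thm. 7.34]
[cite: Murty1988, Thm. 2 (p. 67)] [cite: MumfordAV1970, §21 Thm. 2 (type II)] [cite: Deligne2000, §1] -/
theorem hodgeConjectureFor_powSucc_of_isSimple_isTotallyIndefinite [IsTotallyReal K] (hA : A.IsSimple)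
    (hind : IsTotallyIndefinite K A.endAlgebra) (hdim : A.dim = 2 * Module.finrank ℚ K) (N : ℕ) :
    HodgeConjectureFor (A.powSucc N).dim (A.powSucc N).X :=
  hodgeConjectureFor_of_isDivisorGenerated _
    (AbelianVariety.isDivisorGenerated_powSucc_of_isSimple_isTotallyIndefinite A hA hind hdim N)

/-- **Instance `N = 0`: the Hodge conjecture for `A` itself**, unconditional. [cite: BanaszakGajdaKrason2006, Thm. 7.34]
[cite: MoonenZarhin1999LowDim, (2.2)] [cite: Deligne2000, §1] -/
theorem hodgeConjectureFor_self_of_isSimple_isTotallyIndefinite [IsTotallyReal K] (hA : A.IsSimple)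
    (hind : IsTotallyIndefinite K A.endAlgebra) (hdim : A.dim = 2 * Module.finrank ℚ K) :
    HodgeConjectureFor A.dim A.X :=
  hodgeConjectureFor_powSucc_of_isSimple_isTotallyIndefinite hA hind hdim 0

/-- **The Hodge conjecture for every complex abelian variety isogenous to such a power** (van Geemen Lemma 3.7 =
the tree's `HodgeConjectureFor.of_isIsogenous`). [cite: vanGeemen1994HodgeAV, Lemma 3.7]
[cite: BanaszakGajdaKrason2006, Thm. 7.34] -/
theorem hodgeConjectureFor_of_isIsogenous_powSucc_of_isSimple_isTotallyIndefinite [IsTotallyReal K]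
    {B' : AbelianVariety ℂ} (hA : A.IsSimple) (hind : IsTotallyIndefinite K A.endAlgebra)
    (hdim : A.dim = 2 * Module.finrank ℚ K) {N : ℕ} (hB : B'.IsIsogenous (A.powSucc N)) :
    HodgeConjectureFor B'.dim B'.X :=
  HodgeConjectureFor.of_isIsogenous hB (hodgeConjectureFor_powSucc_of_isSimple_isTotallyIndefinite hA hind hdim N)

end AlbertData

/-- **The involution-keyed form (the tree's sorting key `IsAlbertTypeII`).** For a simple complex abelian variety
`A` and ANY pair `(End⁰(A), ι')` of Albert type II over `K` — `K` totally real, `End⁰(A)` a quaternion algebra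
over `K` split at all infinite places, `ι'` of the first kind (e.g. a Rosati involution; `ι'` itself is not used)
— with `dim A = 2[K:ℚ]`: `B•(A^{N+1}) = D•(A^{N+1}) ⊗ ℂ`. [cite: Lange2023AbelianVarietiesComplex, §2.6.1 Proposition and Thm. 2.6.5 (b)]
[cite: BanaszakGajdaKrason2006, p. 36 and Thm. 7.34] [cite: Murty1988, Thm. 2 (p. 67)] -/
theorem AbelianVariety.isDivisorGenerated_powSucc_of_isSimple_isAlbertTypeII [Algebra K A.endAlgebra]
    [IsScalarTower ℚ K A.endAlgebra] (hA : A.IsSimple) {ι' : A.endAlgebra →ₗ[ℚ] A.endAlgebra}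
    (h : IsAlbertTypeII K A.endAlgebra ι') (hdim : A.dim = 2 * Module.finrank ℚ K) (N : ℕ) :
    IsDivisorGenerated (A.powSucc N) := by
  haveI := h.isTotallyReal
  haveI := h.isQuaternionAlgebra
  exact AbelianVariety.isDivisorGenerated_powSucc_of_isSimple_isTotallyIndefinite A hA h.isTotallyIndefinite hdim N

/-- **The Hodge conjecture for all powers of a simple complex abelian variety carrying a pair of Albert type II
with `dim A = 2[K:ℚ]`**, unconditional. [cite: Lange2023AbelianVarietiesComplex, §2.6.1 Proposition and Thm. 2.6.5 (b)]
[cite: BanaszakGajdaKrason2006, Thm. 7.34] [cite: Murty1988, Thm. 2 (p. 67)] [cite: Deligne2000, §1] -/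
theorem hodgeConjectureFor_powSucc_of_isSimple_isAlbertTypeII [Algebra K A.endAlgebra]
    [IsScalarTower ℚ K A.endAlgebra] (hA : A.IsSimple) {ι' : A.endAlgebra →ₗ[ℚ] A.endAlgebra}
    (h : IsAlbertTypeII K A.endAlgebra ι') (hdim : A.dim = 2 * Module.finrank ℚ K) (N : ℕ) :
    HodgeConjectureFor (A.powSucc N).dim (A.powSucc N).X :=
  hodgeConjectureFor_of_isDivisorGenerated _
    (AbelianVariety.isDivisorGenerated_powSucc_of_isSimple_isAlbertTypeII hA h hdim N)

/-! ### §3 Spellings: QM abelian surfaces (Moonen–Zarhin Type 2(1), `K = ℚ`) and type II(3) sixfolds (the cell's atlas row) -/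

section Spellings

/-- **Abelian surfaces with quaternionic multiplication and ALL THEIR POWERS (Moonen–Zarhin 1999 (2.2) Type 2(1):
«`D = End⁰(X)` is a quaternion algebra over `ℚ`, split at `∞` … `Hg(X) = U_{D^opp}`»): `B•(A^{N+1}) = D•(A^{N+1}) ⊗ ℂ`**,
for a simple complex abelian surface whose endomorphism algebra is a quaternion algebra over `ℚ` split at the
infinite place. [cite: MoonenZarhin1999LowDim, (2.2) and (1.8)] [cite: BanaszakGajdaKrason2006, Thm. 7.34] -/
theorem AbelianVariety.isDivisorGenerated_powSucc_of_surface_isTotallyIndefinite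
    [IsQuaternionAlgebra ℚ A.endAlgebra] (hA : A.IsSimple) (hind : IsTotallyIndefinite ℚ A.endAlgebra)
    (hdim : A.dim = 2) (N : ℕ) : IsDivisorGenerated (A.powSucc N) :=
  AbelianVariety.isDivisorGenerated_powSucc_of_isSimple_isTotallyIndefinite A hA hind
    (by rw [Module.finrank_self, mul_one]; exact hdim) N

/-- **The Hodge conjecture for all powers of an abelian surface with quaternionic multiplication** (Moonen–Zarhin
Type 2(1)), unconditional, from the Albert data «`End⁰(A)` an indefinite quaternion algebra over `ℚ`».
[cite: MoonenZarhin1999LowDim, (2.2) and (1.8)] [cite: BanaszakGajdaKrason2006, Thm. 7.34] [cite: Deligne2000, §1] -/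
theorem hodgeConjectureFor_powSucc_of_surface_isTotallyIndefinite [IsQuaternionAlgebra ℚ A.endAlgebra]
    (hA : A.IsSimple) (hind : IsTotallyIndefinite ℚ A.endAlgebra) (hdim : A.dim = 2) (N : ℕ) :
    HodgeConjectureFor (A.powSucc N).dim (A.powSucc N).X :=
  hodgeConjectureFor_of_isDivisorGenerated _
    (AbelianVariety.isDivisorGenerated_powSucc_of_surface_isTotallyIndefinite hA hind hdim N)

variable [Algebra K A.endAlgebra] [IsScalarTower ℚ K A.endAlgebra] [IsQuaternionAlgebra K A.endAlgebra]

/-- **Simple abelian SIXFOLDS of type II(3) and all their powers (the cell's atlas row `g6.II(3)`; Banaszak–Gajda–Krasoń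
class 𝒜 with `e = 3`, `d = 2`, `h = 1`): `B•(A^{N+1}) = D•(A^{N+1}) ⊗ ℂ`**, for a simple complex abelian sixfold
whose endomorphism algebra is a quaternion algebra over a totally real CUBIC field, split at its three infinite
places. [cite: BanaszakGajdaKrason2006, p. 36 and Thm. 7.34] [cite: Murty1988, Thm. 2 (p. 67)]
[cite: MumfordAV1970, §21 Thm. 2 (type II)] -/
theorem AbelianVariety.isDivisorGenerated_powSucc_of_sixfold_isTotallyIndefinite_cubic [IsTotallyReal K]
    (hA : A.IsSimple) (hind : IsTotallyIndefinite K A.endAlgebra) (hK : Module.finrank ℚ K = 3)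
    (hdim : A.dim = 6) (N : ℕ) : IsDivisorGenerated (A.powSucc N) :=
  AbelianVariety.isDivisorGenerated_powSucc_of_isSimple_isTotallyIndefinite A hA hind (by rw [hK, hdim]) N

/-- **The Hodge conjecture for all powers of a simple abelian sixfold of type II(3)**, unconditional, from the
Albert data. [cite: BanaszakGajdaKrason2006, Thm. 7.34] [cite: Murty1988, Thm. 2 (p. 67)] [cite: Deligne2000, §1] -/
theorem hodgeConjectureFor_powSucc_of_sixfold_isTotallyIndefinite_cubic [IsTotallyReal K] (hA : A.IsSimple)
    (hind : IsTotallyIndefinite K A.endAlgebra) (hK : Module.finrank ℚ K = 3) (hdim : A.dim = 6) (N : ℕ) :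
    HodgeConjectureFor (A.powSucc N).dim (A.powSucc N).X :=
  hodgeConjectureFor_of_isDivisorGenerated _
    (AbelianVariety.isDivisorGenerated_powSucc_of_sixfold_isTotallyIndefinite_cubic hA hind hK hdim N)

end Spellings

/-! ### §4 Products with CM abelian varieties — the cell's rows; HC_CM enters only here, as an explicit binder -/

section Products

variable [Algebra K A.endAlgebra] [IsScalarTower ℚ K A.endAlgebra] [IsQuaternionAlgebra K A.endAlgebra]

/-- **`HC(A^{N+1} × C) ⟺ HC(C)`** for a simple type II `A` with `dim A = 2[K:ℚ]` (Albert data) and `C` of CM type: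
Lombardo 2016 Lemma 3.4 / Moonen–Zarhin (3.1) for «no type IV» × CM (the tree's
`hodgeConjectureFor_prod_iff_of_hasNoTypeIVFactor_of_isOfCMType`, span fact DISCHARGED) with §1's «no type IV» and
§2's unconditional `HC(A^{N+1})`. [cite: Lombardo2016, Lemma 3.4 (p. 1229)] [cite: MoonenZarhin1999LowDim, (2.2) and (1.8)]
[cite: BanaszakGajdaKrason2006, Thm. 7.34] -/
theorem hodgeConjectureFor_powSucc_prod_iff_of_isSimple_isTotallyIndefinite_of_isOfCMType [IsTotallyReal K]
    (hA : A.IsSimple) (hind : IsTotallyIndefinite K A.endAlgebra) (hdim : A.dim = 2 * Module.finrank ℚ K) (N : ℕ)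
    {C : AbelianVariety ℂ} (hCt : Milne1999.IsOfCMType C) :
    HodgeConjectureFor ((A.powSucc N).prod C).dim ((A.powSucc N).prod C).X ↔ HodgeConjectureFor C.dim C.X := by
  rw [hodgeConjectureFor_prod_iff_of_hasNoTypeIVFactor_of_isOfCMType (A.powSucc N) C
    ((hasNoTypeIVFactor_of_isSimple_isTotallyIndefinite hA hind).powSucc N) hCt]
  exact ⟨fun h => h.2, fun h => ⟨hodgeConjectureFor_powSucc_of_isSimple_isTotallyIndefinite hA hind hdim N, h⟩⟩

/-- **HC_CM ⟹ HC(`A^{N+1} × C`)** for a simple type II `A` with `dim A = 2[K:ℚ]` (Albert data) and `C` of CM type —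
the research route's row, CONDITIONAL ON HC_CM (the binder `hCM`; not a corollary of anything unconditional here).
[cite: Lombardo2016, Lemma 3.4 (p. 1229)] [cite: MoonenZarhin1999LowDim, (2.2) and (1.8)] [cite: Deligne2000, §1] -/
theorem hodgeConjectureFor_powSucc_prod_of_isSimple_isTotallyIndefinite_of_cmHodgeHypothesis [IsTotallyReal K]
    (hCM : ∀ Y : AbelianVariety ℂ, Milne1999.CMHodgeHypothesisAt Y) (hA : A.IsSimple)
    (hind : IsTotallyIndefinite K A.endAlgebra) (hdim : A.dim = 2 * Module.finrank ℚ K) (N : ℕ)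
    {C : AbelianVariety ℂ} (hCt : Milne1999.IsOfCMType C) :
    HodgeConjectureFor ((A.powSucc N).prod C).dim ((A.powSucc N).prod C).X :=
  hodgeConjectureFor_powSucc_prod_of_hasNoTypeIVFactor_of_cmHodgeHypothesis hCM A C
    (hasNoTypeIVFactor_of_isSimple_isTotallyIndefinite hA hind) hCt N
    (hodgeConjectureFor_powSucc_of_isSimple_isTotallyIndefinite hA hind hdim N)

end Products

end Literature.AlgebraicGeometry.HodgeTheory

end
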